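import Summits.NavierStokesRegularity.NavierStokesRegularity.Theorems.FilamentSkeletonRssNormalVariationJunk

/-!
# The junk derivative of the normal-variation clause, and a configuration on which the clause fails

Refutation-first lane `ns-filament-19175-p1` (crux `TransverseReductionR`, stmt-NavierStokesRegularity-19175);
second kernel-checked companion of the desk audit `JUNK-AUDIT-19175.md` (evidence on the item), building
on `FilamentSkeletonRssNormalVariationJunk.lean` (the test field `Y(σ) = (σ sin σ/3) n` switches the
regularised Biot–Savart integral of a perturbed straight filament off for every `s ≠ 0`).

* `deriv_T_eq_zero_of_junk` — the abstract mechanism, in the vocabulary of clause 13 (`u` and `T`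
  given by the defining equations of the box block, any `N`, any filaments `X`): if a test family `Y`
  makes every perturbed Biot–Savart integrand non-integrable for every `s ≠ 0`, then at every point
  where the genuine field `u_X` has a non-zero component normal to the filament, `s ↦ T (X + s•Y) j τ`
  jumps at `s = 0` and `deriv … 0 = 0` (Lean's junk value for a non-differentiable map).
* `clause13_fails_two_parallel_lines` — the model configuration: two parallel straight filaments
  `X_k(σ) = o_k n + σ t` (`o₀ ≠ o₁`, `Γγ_k ≠ 0`, `c_k = 0`).  The genuine field of the other filament
  is a non-zero multiple of `t × n` everywhere (`integral_kernel_pos`), so with the admissible `b = 1`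
  family `Y_k = Y` the premise of clause 13 holds with `L = 0` at every `(j, τ)` and the conclusion
  `‖Y_j τ‖ ≤ 0` fails: the clause, EXACTLY as typed in `TransverseReductionR`/`SelectionBoxR`
  (specialised to `N = 2`, `b = 1`, any `a`, any `cnd`), is FALSE for this configuration — for a reason
  (Bochner/`deriv` junk) unrelated to the linearised tangency operator it is meant to control.

The two lines are not a box (no stagnation structure); the point is the mechanism: for `b ≥ 1` the
box class of the crux is cut down by junk directions, so `SelectionBoxR` should be witnessed with
`b < 1` (where dominated differentiation makes the clause honest), or the clause made junk-proof
(`HasDerivAt` in the premise).  Negative-side bookkeeping; NOT a claim about NS regularity or blow-up.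
-/

set_option linter.dupNamespace false

noncomputable section

namespace Summit.NavierStokesRegularity.NavierStokesRegularity.Theorems

open Set Function Filter MeasureTheory Real
open Literature.Analysis.FluidPDE
open scoped InnerProductSpace Topology

namespace NormalVariationJunk

/-- **The junk derivative.** In the vocabulary of clause 13 of `TransverseReductionR`/`SelectionBoxR`
(`u` = regularised Biot–Savart field of a filament family, `T` = normal part of the frame velocity along
filament `j` of the family): if a test family `Y` switches the Biot–Savart integral of EVERY filament off
for every `s ≠ 0` (each perturbed integrand non-integrable, so Lean's `∫` is `0`), then at every point
`X_j(τ)` where the genuine field `u_X` has a non-zero component normal to the filament, the map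
`s ↦ T (X + s•Y) j τ` jumps at `s = 0`, is not differentiable there, and `deriv … 0 = 0` — the premise
of clause 13 is satisfied at that point with `L = 0`, whatever `Y_j(τ)` is. [folklore] -/
theorem deriv_T_eq_zero_of_junk {N : ℕ} (Γ αp : ℝ) (γ : Fin N → ℝ)
    (X Y : Fin N → ℝ → EuclideanSpace ℝ (Fin 3))
    (u : (Fin N → ℝ → EuclideanSpace ℝ (Fin 3)) → EuclideanSpace ℝ (Fin 3) → EuclideanSpace ℝ (Fin 3))
    (T : (Fin N → ℝ → EuclideanSpace ℝ (Fin 3)) → Fin N → ℝ → EuclideanSpace ℝ (Fin 3))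
    (hu : ∀ Z y, u Z y = ∑ k, (Γ * γ k / (4 * Real.pi)) • ∫ σ : ℝ, ((‖y - Z k σ‖ ^ 2 + 1) ^ (3/2:ℝ))⁻¹ •
      cross (deriv (Z k) σ) (y - Z k σ))
    (hT : ∀ Z j τ, T Z j τ = (u Z (Z j τ) + (1/2:ℝ) • Z j τ - αp • cross (EuclideanSpace.single 2 1) (Z j τ))
      - (⟪u Z (Z j τ) + (1/2:ℝ) • Z j τ - αp • cross (EuclideanSpace.single 2 1) (Z j τ), deriv (Z j) τ⟫_ℝ
        / ‖deriv (Z j) τ‖ ^ 2) • deriv (Z j) τ)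
    (hjunk : ∀ s : ℝ, s ≠ 0 → ∀ (k : Fin N) (y : EuclideanSpace ℝ (Fin 3)),
      ¬ Integrable (fun σ : ℝ => ((‖y - (X k σ + s • Y k σ)‖ ^ 2 + 1) ^ (3/2:ℝ))⁻¹ •
        cross (deriv (fun σ => X k σ + s • Y k σ) σ) (y - (X k σ + s • Y k σ))))
    (j : Fin N) (τ : ℝ) (hXd : DifferentiableAt ℝ (X j) τ) (hYd : DifferentiableAt ℝ (Y j) τ)
    (ht0 : deriv (X j) τ ≠ 0)
    (hnormal : u X (X j τ) - (⟪u X (X j τ), deriv (X j) τ⟫_ℝ / ‖deriv (X j) τ‖ ^ 2) • deriv (X j) τ ≠ 0) :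
    deriv (fun s : ℝ => T (fun k σ => X k σ + s • Y k σ) j τ) 0 = 0 := by
  -- notation
  set P := X j τ with hP
  set Q := Y j τ with hQ
  set t := deriv (X j) τ with ht
  set t' := deriv (Y j) τ with ht'
  set e₃ : EuclideanSpace ℝ (Fin 3) := EuclideanSpace.single 2 1 with he₃
  -- tangent of the perturbed filament
  have htan : ∀ s : ℝ, deriv (fun σ => X j σ + s • Y j σ) τ = t + s • t' := fun s => by
    have h1 : HasDerivAt (X j) t τ := hXd.hasDerivAt
    have h2 : HasDerivAt (fun σ => s • Y j σ) (s • t') τ := hYd.hasDerivAt.const_smul s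
    exact (h1.add h2).deriv
  -- the `u`-free candidate limit
  set G : ℝ → EuclideanSpace ℝ (Fin 3) := fun s =>
    ((1/2:ℝ) • (P + s • Q) - αp • cross e₃ (P + s • Q)) -
      (⟪(1/2:ℝ) • (P + s • Q) - αp • cross e₃ (P + s • Q), t + s • t'⟫_ℝ / ‖t + s • t'‖ ^ 2) •
        (t + s • t') with hG
  -- for `s ≠ 0` the Biot–Savart field is switched off
  have hu0 : ∀ s : ℝ, s ≠ 0 → ∀ y, u (fun k σ => X k σ + s • Y k σ) y = 0 := fun s hs y => by
    rw [hu]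
    refine Finset.sum_eq_zero fun k _ => ?_
    rw [integral_undef (hjunk s hs k y), smul_zero]
  have hfs : ∀ s : ℝ, s ≠ 0 → T (fun k σ => X k σ + s • Y k σ) j τ = G s := fun s hs => by
    rw [hT, hu0 s hs, zero_add, htan s]
  -- at `s = 0` the genuine field enters
  have hZ0 : (fun k σ => X k σ + (0:ℝ) • Y k σ) = X := by
    funext k σ; rw [zero_smul, add_zero]
  have hf0 : T (fun k σ => X k σ + (0:ℝ) • Y k σ) j τ =
      G 0 + (u X P - (⟪u X P, t⟫_ℝ / ‖t‖ ^ 2) • t) := by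
    rw [hZ0, hT, hG]
    simp only [zero_smul, add_zero, ← hP, ← ht]
    have hN : ∀ a b : EuclideanSpace ℝ (Fin 3), (a + b) - (⟪a + b, t⟫_ℝ / ‖t‖ ^ 2) • t =
        (a - (⟪a, t⟫_ℝ / ‖t‖ ^ 2) • t) + (b - (⟪b, t⟫_ℝ / ‖t‖ ^ 2) • t) := fun a b => by
      rw [inner_add_left, add_div, add_smul]; abel
    rw [show u X P + (1/2:ℝ) • P - αp • cross e₃ P = ((1/2:ℝ) • P - αp • cross e₃ P) + u X P by abel,
      hN]
  -- `G` is continuous at `0`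
  have hGc : ContinuousAt G 0 := by
    have htc : Continuous fun s : ℝ => t + s • t' := by fun_prop
    have hVc : Continuous fun s : ℝ => (1/2:ℝ) • (P + s • Q) - αp • cross e₃ (P + s • Q) := by
      have : Continuous fun s : ℝ => cross e₃ (P + s • Q) :=
        (crossCLM e₃).continuous.comp (by fun_prop : Continuous fun s : ℝ => P + s • Q)
      fun_prop
    have hden : Continuous fun s : ℝ => ‖t + s • t'‖ ^ 2 := by fun_prop
    have hden0 : ‖t + (0:ℝ) • t'‖ ^ 2 ≠ 0 := by
      rw [zero_smul, add_zero]; exact pow_ne_zero 2 (norm_ne_zero_iff.2 ht0)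
    have hq : ContinuousAt (fun s : ℝ => ⟪(1/2:ℝ) • (P + s • Q) - αp • cross e₃ (P + s • Q), t + s • t'⟫_ℝ
        / ‖t + s • t'‖ ^ 2) 0 :=
      ((hVc.inner htc).continuousAt).div hden.continuousAt hden0
    rw [hG]
    exact (hVc.continuousAt).sub (hq.smul htc.continuousAt)
  -- if the map were differentiable at 0 it would be continuous there, forcing the normal part to vanish
  apply deriv_zero_of_not_differentiableAt
  intro hdiff
  have hcont := hdiff.continuousAt
  have hlim1 : Tendsto (fun s : ℝ => T (fun k σ => X k σ + s • Y k σ) j τ) (𝓝[≠] 0)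
      (𝓝 (T (fun k σ => X k σ + (0:ℝ) • Y k σ) j τ)) := hcont.tendsto.mono_left nhdsWithin_le_nhds
  have hlim2 : Tendsto (fun s : ℝ => T (fun k σ => X k σ + s • Y k σ) j τ) (𝓝[≠] 0) (𝓝 (G 0)) := by
    refine (hGc.tendsto.mono_left nhdsWithin_le_nhds).congr' ?_
    exact eventually_nhdsWithin_of_forall fun s hs => (hfs s hs).symm
  have heq := tendsto_nhds_unique hlim1 hlim2
  rw [hf0] at heq
  apply hnormal
  have : u X P - (⟪u X P, t⟫_ℝ / ‖t‖ ^ 2) • t = (G 0 + (u X P - (⟪u X P, t⟫_ℝ / ‖t‖ ^ 2) • t)) - G 0 := by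
    abel
  rw [this, heq, sub_self]

/-! ### A concrete configuration: two parallel straight filaments -/

/-- The kernel `((δ² + (τ−σ)² + 1)^{3/2})⁻¹` is integrable and has positive integral. [folklore] -/
theorem integral_kernel_pos (δ τ : ℝ) :
    Integrable (fun σ : ℝ => ((δ ^ 2 + (τ - σ) ^ 2 + 1) ^ (3/2:ℝ))⁻¹) ∧
      0 < ∫ σ : ℝ, ((δ ^ 2 + (τ - σ) ^ 2 + 1) ^ (3/2:ℝ))⁻¹ := by
  have hpos : ∀ σ : ℝ, 0 < ((δ ^ 2 + (τ - σ) ^ 2 + 1) ^ (3/2:ℝ))⁻¹ := fun σ =>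
    inv_pos.2 (Real.rpow_pos_of_pos (by positivity) _)
  have hint : Integrable (fun σ : ℝ => ((δ ^ 2 + (τ - σ) ^ 2 + 1) ^ (3/2:ℝ))⁻¹) := by
    have hdom : Integrable (fun σ : ℝ => (1 + (1 * (σ - τ)) ^ 2)⁻¹) :=
      (integrable_inv_one_add_sq.comp_mul_left' one_ne_zero).comp_sub_right τ
    refine hdom.mono' ?_ (Eventually.of_forall fun σ => ?_)
    · have hc : Continuous fun σ : ℝ => (δ ^ 2 + (τ - σ) ^ 2 + 1) ^ (3/2:ℝ) :=
        (by fun_prop : Continuous fun σ : ℝ => δ ^ 2 + (τ - σ) ^ 2 + 1).rpow_const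
          fun σ => Or.inr (by norm_num)
      exact (hc.inv₀ fun σ => (Real.rpow_pos_of_pos (by positivity) _).ne').aestronglyMeasurable
    · have hA : 1 ≤ δ ^ 2 + (τ - σ) ^ 2 + 1 := by nlinarith [sq_nonneg δ, sq_nonneg (τ - σ)]
      have hA0 : 0 < δ ^ 2 + (τ - σ) ^ 2 + 1 := by linarith
      rw [Real.norm_eq_abs, abs_of_pos (hpos σ), one_mul]
      have h32 : δ ^ 2 + (τ - σ) ^ 2 + 1 ≤ (δ ^ 2 + (τ - σ) ^ 2 + 1) ^ (3/2:ℝ) := by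
        calc δ ^ 2 + (τ - σ) ^ 2 + 1 = (δ ^ 2 + (τ - σ) ^ 2 + 1) ^ (1:ℝ) := (Real.rpow_one _).symm
          _ ≤ (δ ^ 2 + (τ - σ) ^ 2 + 1) ^ (3/2:ℝ) :=
              Real.rpow_le_rpow_of_exponent_le hA (by norm_num)
      calc ((δ ^ 2 + (τ - σ) ^ 2 + 1) ^ (3/2:ℝ))⁻¹ ≤ (δ ^ 2 + (τ - σ) ^ 2 + 1)⁻¹ := inv_anti₀ hA0 h32
        _ ≤ (1 + (σ - τ) ^ 2)⁻¹ := by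
            apply inv_anti₀ (by positivity)
            nlinarith [sq_nonneg δ]
  refine ⟨hint, ?_⟩
  rw [integral_pos_iff_support_of_nonneg (fun σ => (hpos σ).le) hint]
  have hsupp : Function.support (fun σ : ℝ => ((δ ^ 2 + (τ - σ) ^ 2 + 1) ^ (3/2:ℝ))⁻¹) = univ :=
    eq_univ_of_forall fun σ => (hpos σ).ne'
  rw [hsupp, Real.volume_univ]
  exact ENNReal.zero_lt_top

/-- **Clause 13 fails, by junk, for two parallel straight filaments (`b = 1`, every `a`, every
`cnd`).** Filaments `X_k(σ) = o_k n + σ t` (`t ⊥ n` unit, `o₀ ≠ o₁`), circulations `Γγ_k ≠ 0`, waist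
parameters `c_k = 0`; `u`, `T` exactly as in the box block of `TransverseReductionR`/`SelectionBoxR`.
The test family `Y_k(σ) = (σ sin σ/3) n` is admissible for `b = 1` (`testField_admissible`); it switches
every perturbed Biot–Savart integral off (`not_integrable_perturbedLine`), while the genuine field of
the other filament is a non-zero multiple of `t × n` at every point of each filament
(`integral_kernel_pos`); so `deriv (fun s => T (X + s•Y) j τ) 0 = 0` everywhere
(`deriv_T_eq_zero_of_junk`), the premise holds with `L = 0`, and the conclusion `‖Y_j τ‖ ≤ 0` is false
at `τ = π/2`.  This is the model case of JUNK-AUDIT-19175 §2: the clause, as typed, excludes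
configurations for reasons unrelated to the linearised tangency operator. [folklore] -/
theorem clause13_fails_two_parallel_lines (Γ αp a cnd : ℝ) (γ o : Fin 2 → ℝ)
    (t n : EuclideanSpace ℝ (Fin 3)) (ht : ‖t‖ = 1) (hn : ‖n‖ = 1) (htn : ⟪t, n⟫_ℝ = 0)
    (hΓ : Γ ≠ 0) (hγ : ∀ k, γ k ≠ 0) (ho : o 0 ≠ o 1)
    (u : (Fin 2 → ℝ → EuclideanSpace ℝ (Fin 3)) → EuclideanSpace ℝ (Fin 3) → EuclideanSpace ℝ (Fin 3))
    (T : (Fin 2 → ℝ → EuclideanSpace ℝ (Fin 3)) → Fin 2 → ℝ → EuclideanSpace ℝ (Fin 3))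
    (hu : ∀ Z y, u Z y = ∑ k, (Γ * γ k / (4 * Real.pi)) • ∫ σ : ℝ, ((‖y - Z k σ‖ ^ 2 + 1) ^ (3/2:ℝ))⁻¹ •
      cross (deriv (Z k) σ) (y - Z k σ))
    (hT : ∀ Z j τ, T Z j τ = (u Z (Z j τ) + (1/2:ℝ) • Z j τ - αp • cross (EuclideanSpace.single 2 1) (Z j τ))
      - (⟪u Z (Z j τ) + (1/2:ℝ) • Z j τ - αp • cross (EuclideanSpace.single 2 1) (Z j τ), deriv (Z j) τ⟫_ℝ
        / ‖deriv (Z j) τ‖ ^ 2) • deriv (Z j) τ) :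
    ¬ (∀ Y : Fin 2 → ℝ → EuclideanSpace ℝ (Fin 3), (∀ j, ContDiff ℝ 2 (Y j)) →
      (∀ j τ, ⟪Y j τ, deriv (fun σ : ℝ => o j • n + σ • t) τ⟫_ℝ = 0) →
      ∑ j, ⟪Y j ((fun _ : Fin 2 => (0:ℝ)) j), cross (EuclideanSpace.single 2 1)
        ((fun σ : ℝ => o j • n + σ • t) ((fun _ : Fin 2 => (0:ℝ)) j))⟫_ℝ = 0 →
      (∀ j τ, ‖Y j τ‖ + ‖deriv (Y j) τ‖ + ‖iteratedDeriv 2 (Y j) τ‖ ≤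
        (1 + |τ - (fun _ : Fin 2 => (0:ℝ)) j|) ^ (1:ℝ)) →
      ∀ L : ℝ, (∀ j τ, ‖deriv (fun s : ℝ => T (fun k σ => (o k • n + σ • t) + s • Y k σ) j τ) 0‖ ≤
        L * (1 + |τ - (fun _ : Fin 2 => (0:ℝ)) j|) ^ a) →
      ∀ j τ, ‖Y j τ‖ ≤ cnd * L * (1 + |τ - (fun _ : Fin 2 => (0:ℝ)) j|) ^ (1:ℝ)) := by
  intro h13
  set X : Fin 2 → ℝ → EuclideanSpace ℝ (Fin 3) := fun k σ => o k • n + σ • t with hX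
  set Y : Fin 2 → ℝ → EuclideanSpace ℝ (Fin 3) := fun _ σ => (σ * Real.sin σ / 3) • n with hY
  set b := cross t n with hb_def
  have hb : ‖b‖ = 1 := norm_cross_of_orthonormal ht hn htn
  have hbt : ⟪b, t⟫_ℝ = 0 := by
    rw [hb_def]; simp [cross, crossProduct, PiLp.inner_apply, Fin.sum_univ_three]; ring
  have hXd : ∀ k σ, HasDerivAt (X k) t σ := fun k σ => by
    have h := ((hasDerivAt_id' σ).smul_const t).const_add (o k • n)
    simpa [hX] using h
  have hderivX : ∀ k σ, deriv (X k) σ = t := fun k σ => (hXd k σ).deriv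
  -- the genuine field on filament `j` is a non-zero multiple of `b`
  have hnormal : ∀ j τ, u X (X j τ) - (⟪u X (X j τ), deriv (X j) τ⟫_ℝ / ‖deriv (X j) τ‖ ^ 2) •
      deriv (X j) τ ≠ 0 := by
    intro j τ
    -- each Biot–Savart term is `(δ ∫K) • b`, `δ = o j − o k`
    have hterm : ∀ k, ∫ σ : ℝ, ((‖X j τ - X k σ‖ ^ 2 + 1) ^ (3/2:ℝ))⁻¹ • cross (deriv (X k) σ) (X j τ - X k σ)
        = ((o j - o k) * ∫ σ : ℝ, (((o j - o k) ^ 2 + (τ - σ) ^ 2 + 1) ^ (3/2:ℝ))⁻¹) • b := by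
      intro k
      have hfun : (fun σ : ℝ => ((‖X j τ - X k σ‖ ^ 2 + 1) ^ (3/2:ℝ))⁻¹ • cross (deriv (X k) σ) (X j τ - X k σ))
          = fun σ => (((o j - o k) ^ 2 + (τ - σ) ^ 2 + 1) ^ (3/2:ℝ))⁻¹ • ((o j - o k) • b) := by
        funext σ
        have hΔ : X j τ - X k σ = (o j - o k) • n + (τ - σ) • t := by
          simp only [hX]; rw [sub_smul, sub_smul]; abel
        have hnorm : ‖X j τ - X k σ‖ ^ 2 = (o j - o k) ^ 2 + (τ - σ) ^ 2 := by
          rw [hΔ, norm_add_sq_real, norm_smul, norm_smul, Real.norm_eq_abs, Real.norm_eq_abs, hn, ht,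
            real_inner_smul_left, real_inner_smul_right, real_inner_comm, htn]
          simp [sq_abs]
        have hcross : cross (deriv (X k) σ) (X j τ - X k σ) = (o j - o k) • b := by
          rw [hderivX, hΔ, ← crossCLM_apply, map_add, map_smul, map_smul, crossCLM_apply, crossCLM_apply,
            ← hb_def, show cross t t = 0 by simp [cross], smul_zero, add_zero]
        rw [hnorm, hcross]
      rw [hfun, integral_smul_const, smul_smul, mul_comm]
    have hu' : u X (X j τ) = (∑ k : Fin 2, Γ * γ k / (4 * Real.pi) * ((o j - o k) *
        ∫ σ : ℝ, (((o j - o k) ^ 2 + (τ - σ) ^ 2 + 1) ^ (3/2:ℝ))⁻¹)) • b := by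
      rw [hu, Finset.sum_smul]
      exact Finset.sum_congr rfl fun k _ => by rw [hterm k, smul_smul]
    have hcoef : (∑ k : Fin 2, Γ * γ k / (4 * Real.pi) * ((o j - o k) *
        ∫ σ : ℝ, (((o j - o k) ^ 2 + (τ - σ) ^ 2 + 1) ^ (3/2:ℝ))⁻¹)) ≠ 0 := by
      rw [Fin.sum_univ_two]
      have hπ : (4 * Real.pi) ≠ 0 := by positivity
      fin_cases j
      · simp only [Fin.zero_eta, Fin.isValue, sub_self, zero_mul, mul_zero, zero_add]
        have hI := (integral_kernel_pos (o 0 - o 1) τ).2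
        exact mul_ne_zero (div_ne_zero (mul_ne_zero hΓ (hγ 1)) hπ) (mul_ne_zero (sub_ne_zero.2 ho) hI.ne')
      · simp only [Fin.mk_one, Fin.isValue, sub_self, zero_mul, mul_zero, add_zero]
        have hI := (integral_kernel_pos (o 1 - o 0) τ).2
        exact mul_ne_zero (div_ne_zero (mul_ne_zero hΓ (hγ 0)) hπ)
          (mul_ne_zero (sub_ne_zero.2 (Ne.symm ho)) hI.ne')
    rw [hu', hderivX, real_inner_smul_left, hbt, mul_zero, zero_div, zero_smul, sub_zero]
    exact smul_ne_zero hcoef (norm_ne_zero_iff.1 (by rw [hb]; exact one_ne_zero))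
  -- every perturbed Biot–Savart integral is switched off
  have hjunk : ∀ s : ℝ, s ≠ 0 → ∀ (k : Fin 2) (y : EuclideanSpace ℝ (Fin 3)),
      ¬ Integrable (fun σ : ℝ => ((‖y - (X k σ + s • Y k σ)‖ ^ 2 + 1) ^ (3/2:ℝ))⁻¹ •
        cross (deriv (fun σ => X k σ + s • Y k σ) σ) (y - (X k σ + s • Y k σ))) := by
    intro s hs k y
    have hfun : (fun σ : ℝ => ((‖y - (X k σ + s • Y k σ)‖ ^ 2 + 1) ^ (3/2:ℝ))⁻¹ •
        cross (deriv (fun σ => X k σ + s • Y k σ) σ) (y - (X k σ + s • Y k σ))) =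
        fun σ : ℝ => ((‖(y - o k • n) - (σ • t + s • ((σ * Real.sin σ / 3) • n))‖ ^ 2 + 1) ^ (3/2:ℝ))⁻¹ •
        cross (deriv (fun σ : ℝ => σ • t + s • ((σ * Real.sin σ / 3) • n)) σ)
          ((y - o k • n) - (σ • t + s • ((σ * Real.sin σ / 3) • n))) := by
      funext σ
      have h1 : y - (X k σ + s • Y k σ) = (y - o k • n) - (σ • t + s • ((σ * Real.sin σ / 3) • n)) := by
        simp only [hX, hY]; abel
      have h2 : deriv (fun σ => X k σ + s • Y k σ) σ =
          deriv (fun σ : ℝ => σ • t + s • ((σ * Real.sin σ / 3) • n)) σ := by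
        simp only [hX, hY]
        rw [show (fun σ : ℝ => o k • n + σ • t + s • ((σ * Real.sin σ / 3) • n)) =
          fun σ : ℝ => o k • n + (σ • t + s • ((σ * Real.sin σ / 3) • n)) from funext fun σ => add_assoc _ _ _]
        exact deriv_const_add _
      rw [h1, h2]
    rw [hfun]
    exact not_integrable_perturbedLine t n (y - o k • n) ht hn htn hs
  -- hence the junk derivative vanishes everywhere
  have hderiv0 : ∀ j τ, deriv (fun s : ℝ => T (fun k σ => X k σ + s • Y k σ) j τ) 0 = 0 := fun j τ =>
    deriv_T_eq_zero_of_junk Γ αp γ X Y u T hu hT hjunk j τ (hXd j τ).differentiableAt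
      (hasDerivAt_testField n τ).differentiableAt (by rw [hderivX, ← norm_ne_zero_iff, ht]; exact one_ne_zero)
      (hnormal j τ)
  -- test clause 13 on `Y` with `L = 0`
  have h := h13 Y (fun _ => contDiff_testField n)
    (fun j τ => by rw [show (fun σ : ℝ => o j • n + σ • t) = X j from rfl, hderivX]; exact (testField_admissible hn htn τ).1)
    (by simp [hY])
    (fun j τ => (testField_admissible (t := t) hn htn τ).2) 0
    (fun j τ => by
      rw [show (fun s : ℝ => T (fun k σ => (o k • n + σ • t) + s • Y k σ) j τ) =
          fun s : ℝ => T (fun k σ => X k σ + s • Y k σ) j τ from rfl, hderiv0 j τ, norm_zero, zero_mul])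
    0 (Real.pi / 2)
  simp only [hY, mul_zero, zero_mul, Real.sin_pi_div_two, mul_one, norm_smul, hn, Real.norm_eq_abs] at h
  have : (0:ℝ) < |Real.pi / 2 / 3| := abs_pos.2 (by positivity)
  linarith

end NormalVariationJunk

end Summit.NavierStokesRegularity.NavierStokesRegularity.Theorems
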